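import Summits.ValiantsHypothesis.ValiantsHypothesis.Theorems.LacunarySymmetroidMatrixDescartesLagrangeTowerSecular

/-!
# `MatrixDescartes` census — arrowhead Lagrange tower: the secular identity and the inherited alternation of the sign characteristic

HONEST FRAMING.  Object-search cell `pub-symmetroid`, crux `Theses.LacunarySymmetroid.MatrixDescartes`
(stmt-ValiantsHypothesis-18050); seat val-sym-mdr-p1 (g2).  Part of the kernel port of the cell's THEOREM L (conjb-3 g3, ROUND3-MEMO §1;
paper-checked by conjb-1 g2 and theory g21) in the arrowhead / secular form of `…LagrangeTowerDefs`: for EVERY `m ≥ 1` some real symmetric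
three-term lacunary `m × m` pencil has `C(m+2,2) − 1` distinct positive determinant roots, so `KThreeColumnLaw` (CONJECTURE A3) holds.
This is a LOWER-bound / Descartes-extremality statement for the thin `K = 3` column (CONJECTURE-A currency); it proves nothing about
the crux `MatrixDescartes` (an upper-bound statement at fat formats) and nothing about `VP ≠ VNP`.  No definitions in this file.

THIS FILE. Given the alternation of the child level (`0 < θ (−1)^l β_l`): the radicand of `c_l = √(−η r_l β_l)` is positive
(`radicand_pos`), the SECULAR IDENTITY `ψ(x)·N(x) = η·P(x)` off the child's roots (`ψfun_mul_Npoly`), hence `ψ(z_i) = 0` at every parent root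
(`ψfun_root`), and — differentiating the secular identity at `z_i` (`HasDerivAt`, `Polynomial.hasDerivAt`) — `βnew i · N(z_i) = η · P'(z_i)`
(`βnew_mul_Npoly`), whence the new sign characteristic alternates: `0 < η (−1)^i βnew i` (`βnew_alt`).  This replaces Lemma 3 (Sylvester
inertia / Cauchy interlacing) of the paper proof by one line of calculus. [folklore]
-/

-- `Summit.ValiantsHypothesis.ValiantsHypothesis.…` repeats a component by the D-0017 layout
-- (single-conjunct summit), which the `dupNamespace` linter flags; the name is mandated.
set_option linter.dupNamespace false

namespace Summit.ValiantsHypothesis.ValiantsHypothesis.Theorems.LacunarySymmetroidMatrixDescartes.Census.LagrangeTower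

open Matrix Polynomial Finset
open scoped BigOperators

section Secular

variable {k : ℕ} (d : TowerData k)

/-- `η² = 1`. -/
theorem ηnew_sq (hθ : d.θ = 1 ∨ d.θ = -1) : ηnew d * ηnew d = 1 := by
  unfold ηnew
  have h1 : ((-1 : ℝ) ^ k) * (-1) ^ k = 1 := by rw [← pow_add, ← two_mul, pow_mul]; norm_num
  rcases hθ with h | h <;> · rw [h]; linear_combination h1

/-- `η = ±1`. -/
theorem ηnew_cases (hθ : d.θ = 1 ∨ d.θ = -1) : ηnew d = 1 ∨ ηnew d = -1 := by
  unfold ηnew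
  rcases neg_one_pow_eq_or ℝ k with h | h <;> rcases hθ with h' | h' <;> simp [h, h']

/-- The radicand of `c_l` is positive: `0 < −η·r_l·β_l` (this is where the alternation of the child is used). -/
theorem radicand_pos (halt : ∀ l : Fin k, 0 < d.θ * (-1) ^ (l : ℕ) * d.β l) (l : Fin k) :
    0 < -(ηnew d * rcoef k l * d.β l) := by
  have h1 := halt l
  have h2 := eval_Nlpoly_root_sign k l
  have h3 := eval_Ppoly_child_root_pos k l
  have hl : (l : ℕ) + 1 ≤ k := l.isLt
  -- `-(η r β) = (θ (−1)^l β) · ((−1)^{k−1−l} N_l(ν_l))⁻¹ · P(ν_l)` up to the square `((−1)^{k−1−l})² = 1`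
  have hpow : -((-1 : ℝ) ^ k) = (-1) ^ (l : ℕ) * (-1) ^ (k - 1 - (l : ℕ)) := by
    rw [← pow_add]
    obtain ⟨j, hj⟩ : ∃ j, k = j + 1 := ⟨k - 1, by omega⟩
    subst hj
    have : (l : ℕ) + (j + 1 - 1 - (l : ℕ)) = j := by omega
    rw [this, pow_succ]; ring
  set a := d.θ * (-1) ^ (l : ℕ) * d.β l with ha
  set b := (-1) ^ (k - 1 - (l : ℕ)) * (Nlpoly k l).eval (zroot k l) with hb
  set p := (Ppoly k).eval (zroot k l) with hp
  have hsq : ((-1 : ℝ) ^ (k - 1 - (l : ℕ))) * (-1) ^ (k - 1 - (l : ℕ)) = 1 := by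
    rw [← pow_add, ← two_mul, pow_mul]; norm_num
  have hb' : (Nlpoly k l).eval (zroot k l) = (-1) ^ (k - 1 - (l : ℕ)) * b := by
    rw [hb, ← mul_assoc, hsq, one_mul]
  have key : -(ηnew d * rcoef k l * d.β l) = a * p / b := by
    unfold ηnew rcoef
    rw [hb', ha]
    have hbne : b ≠ 0 := ne_of_gt h2
    field_simp
    linear_combination (d.θ * (Ppoly k).eval (zroot k l) * d.β l) * hpow
  rw [key]
  positivity

/-- `c_l² = −η r_l β_l`. -/
theorem cvec_sq (halt : ∀ l : Fin k, 0 < d.θ * (-1) ^ (l : ℕ) * d.β l) (l : Fin k) :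
    cvec d l ^ 2 = -(ηnew d * rcoef k l * d.β l) := by
  unfold cvec
  rw [Real.sq_sqrt (radicand_pos d halt l).le]

/-- `0 < c_l`. -/
theorem cvec_pos (halt : ∀ l : Fin k, 0 < d.θ * (-1) ^ (l : ℕ) * d.β l) (l : Fin k) : 0 < cvec d l := by
  unfold cvec; exact Real.sqrt_pos.mpr (radicand_pos d halt l)

/-- An alternating sign characteristic has no zero entry. -/
theorem β_ne_zero (halt : ∀ l : Fin k, 0 < d.θ * (-1) ^ (l : ℕ) * d.β l) (l : Fin k) : d.β l ≠ 0 := by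
  intro h; have := halt l; rw [h, mul_zero] at this; exact lt_irrefl _ this

/-- `c_l² / β_l = −η r_l`. -/
theorem cvec_sq_div (halt : ∀ l : Fin k, 0 < d.θ * (-1) ^ (l : ℕ) * d.β l) (l : Fin k) :
    cvec d l ^ 2 / d.β l = -(ηnew d * rcoef k l) := by
  rw [cvec_sq d halt l]
  field_simp [β_ne_zero d halt l]

/-- **The secular identity**: `ψ(x) · N(x) = η · P(x)` off the child's roots. -/
theorem ψfun_mul_Npoly (halt : ∀ l : Fin k, 0 < d.θ * (-1) ^ (l : ℕ) * d.β l) {x : ℝ} (hx : ∀ l, x ≠ zroot k l) :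
    ψfun d x * (Npoly k).eval x = ηnew d * (Ppoly k).eval x := by
  have hterm : ∀ l : Fin k,
      cvec d l ^ 2 / d.β l / (x - zroot k l) * (Npoly k).eval x = -(ηnew d * rcoef k l) * (Nlpoly k l).eval x := by
    intro l
    rw [eval_Npoly_eq_mul k l x, ← cvec_sq_div d halt l]
    have : x - zroot k l ≠ 0 := sub_ne_zero.mpr (hx l)
    field_simp
  unfold ψfun
  rw [eval_Ppoly_eq k x, sub_mul, Finset.sum_mul]
  simp_rw [hterm]
  rw [mul_add, Finset.mul_sum]
  have : ∑ l, -(ηnew d * rcoef k l) * (Nlpoly k l).eval x = -∑ l, ηnew d * (rcoef k l * (Nlpoly k l).eval x) := by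
    rw [← Finset.sum_neg_distrib]
    exact Finset.sum_congr rfl fun l _ => by ring
  rw [this]
  ring

/-- `ψ` vanishes at every parent root `z_i`. -/
theorem ψfun_root (halt : ∀ l : Fin k, 0 < d.θ * (-1) ^ (l : ℕ) * d.β l) (i : Fin (k + 1)) :
    ψfun d (zroot (k + 1) i) = 0 := by
  have h := ψfun_mul_Npoly d halt (x := zroot (k + 1) i) fun l => (zroot_succ_lt k i l).ne
  rw [eval_Ppoly_root, mul_zero] at h
  exact (mul_eq_zero.mp h).resolve_right (eval_Npoly_parent_root_ne_zero k i)

/-! ### The derivative of the secular function and the sign of `βnew` -/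

/-- The secular function is differentiable off the child roots, with derivative `ψder`. -/
theorem hasDerivAt_ψfun {x : ℝ} (hx : ∀ l, x ≠ zroot k l) : HasDerivAt (ψfun d) (ψder d x) x := by
  have hL : HasDerivAt (fun y => ηnew d * (Lpoly k).eval y) (ηnew d * lslope k) x := by
    have : (fun y => ηnew d * (Lpoly k).eval y) = fun y => ηnew d * (lconst k + lslope k * y) := by
      funext y; rw [eval_Lpoly]
    rw [this]
    have h1 : HasDerivAt (fun y => lconst k + lslope k * y) (lslope k) x := by
      simpa using ((hasDerivAt_id x).const_mul (lslope k)).const_add (lconst k)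
    exact h1.const_mul (ηnew d)
  have hS : HasDerivAt (fun y => ∑ l, cvec d l ^ 2 / d.β l / (y - zroot k l))
      (∑ l, -(cvec d l ^ 2 / d.β l / (x - zroot k l) ^ 2)) x := by
    refine HasDerivAt.fun_sum fun l _ => ?_
    have hne : x - zroot k l ≠ 0 := sub_ne_zero.mpr (hx l)
    have h1 : HasDerivAt (fun y => y - zroot k l) 1 x := (hasDerivAt_id x).sub_const _
    have h2 := (hasDerivAt_const x (cvec d l ^ 2 / d.β l)).div h1 hne
    have hval : (0 * (x - zroot k l) - cvec d l ^ 2 / d.β l * 1) / (x - zroot k l) ^ 2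
        = -(cvec d l ^ 2 / d.β l / (x - zroot k l) ^ 2) := by
      rw [zero_mul, zero_sub, mul_one, neg_div]
    rw [hval] at h2
    exact h2
  have hval : ψder d x = ηnew d * lslope k - ∑ l, -(cvec d l ^ 2 / d.β l / (x - zroot k l) ^ 2) := by
    unfold ψder
    rw [Finset.sum_neg_distrib, sub_neg_eq_add]
  rw [hval]
  exact hL.sub hS

/-- The complement of the child roots is open. -/
theorem isOpen_nonroot (k : ℕ) : IsOpen {x : ℝ | ∀ l : Fin k, x ≠ zroot k l} := by
  have : {x : ℝ | ∀ l : Fin k, x ≠ zroot k l} = ⋂ l : Fin k, {zroot k l}ᶜ := by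
    ext x; simp
  rw [this]
  exact isOpen_iInter_of_finite fun l => isOpen_compl_singleton

/-- **`βnew i · N(z_i) = η · P'(z_i)`** — differentiate the secular identity at the parent root `z_i`. -/
theorem βnew_mul_Npoly (halt : ∀ l : Fin k, 0 < d.θ * (-1) ^ (l : ℕ) * d.β l) (i : Fin (k + 1)) :
    βnew d i * (Npoly k).eval (zroot (k + 1) i)
      = ηnew d * (Polynomial.derivative (Ppoly k)).eval (zroot (k + 1) i) := by
  set z := zroot (k + 1) i with hz
  have hzν : ∀ l, z ≠ zroot k l := fun l => (zroot_succ_lt k i l).ne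
  -- derivative of the left-hand side `ψ · N`
  have hψ : HasDerivAt (ψfun d) (ψder d z) z := hasDerivAt_ψfun d hzν
  have hN : HasDerivAt (fun y => (Npoly k).eval y) ((Polynomial.derivative (Npoly k)).eval z) z :=
    Polynomial.hasDerivAt _ _
  have hprod := hψ.mul hN
  -- derivative of the right-hand side `η · P`
  have hP : HasDerivAt (fun y => ηnew d * (Ppoly k).eval y)
      (ηnew d * (Polynomial.derivative (Ppoly k)).eval z) z :=
    (Polynomial.hasDerivAt _ _).const_mul _
  -- the two functions agree near `z`
  have heq : (fun y => ψfun d y * (Npoly k).eval y) =ᶠ[nhds z] fun y => ηnew d * (Ppoly k).eval y := by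
    filter_upwards [(isOpen_nonroot k).mem_nhds (show z ∈ {x : ℝ | ∀ l : Fin k, x ≠ zroot k l} from hzν)]
      with y hy
    exact ψfun_mul_Npoly d halt hy
  have h2 := (hprod.congr_of_eventuallyEq heq.symm).unique hP
  -- `ψ(z) = 0` kills the second term
  rw [ψfun_root d halt i, zero_mul, add_zero] at h2
  unfold βnew
  exact h2

/-- `P'(z_i) = ∏_{j ≠ i} (z_i − z_j)`. -/
theorem eval_derivative_Ppoly (i : Fin (k + 1)) :
    (Polynomial.derivative (Ppoly k)).eval (zroot (k + 1) i)
      = ∏ j ∈ univ.erase i, (zroot (k + 1) i - zroot (k + 1) j) := by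
  classical
  unfold Ppoly
  rw [Polynomial.derivative_prod_finset, Polynomial.eval_finsetSum, Finset.sum_eq_single i]
  · simp [Polynomial.eval_prod]
  · intro j _ hj
    rw [Polynomial.eval_mul, Polynomial.eval_prod]
    have : ∏ l ∈ univ.erase j, (X - C (zroot (k + 1) l)).eval (zroot (k + 1) i) = 0 :=
      Finset.prod_eq_zero (Finset.mem_erase.mpr ⟨fun h => hj (h ▸ rfl) |>.elim, mem_univ i⟩) (by simp)
    rw [this, zero_mul]
  · intro h; exact absurd (mem_univ i) h

/-- `P'(z_i)` has sign `(−1)^{k−i}`. -/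
theorem eval_derivative_Ppoly_sign (i : Fin (k + 1)) :
    0 < (-1) ^ (k - (i : ℕ)) * (Polynomial.derivative (Ppoly k)).eval (zroot (k + 1) i) := by
  rw [eval_derivative_Ppoly]
  have := prod_erase_sub_sign _ (zroot_strictMono (k + 1)) i
  simpa using this

/-- **Alternation is inherited**: `0 < η · (−1)^i · βnew i`. -/
theorem βnew_alt (halt : ∀ l : Fin k, 0 < d.θ * (-1) ^ (l : ℕ) * d.β l) (hθ : d.θ = 1 ∨ d.θ = -1)
    (i : Fin (k + 1)) : 0 < ηnew d * (-1) ^ (i : ℕ) * βnew d i := by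
  have hkey := βnew_mul_Npoly d halt i
  have hN := eval_Npoly_parent_root_sign k i
  have hP := eval_derivative_Ppoly_sign (k := k) i
  have hηsq := ηnew_sq d hθ
  have hi : (i : ℕ) ≤ k := Nat.lt_succ_iff.mp i.isLt
  set P' := (Polynomial.derivative (Ppoly k)).eval (zroot (k + 1) i) with hP'
  set N := (Npoly k).eval (zroot (k + 1) i) with hNdef
  have hpow : ((-1 : ℝ) ^ (i : ℕ)) * (-1) ^ k = (-1) ^ (k - (i : ℕ)) := by
    rw [← pow_add]
    have : (i : ℕ) + k = (k - (i : ℕ)) + 2 * (i : ℕ) := by omega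
    rw [this, pow_add, pow_mul]; norm_num
  have h1 : (ηnew d * (-1) ^ (i : ℕ) * βnew d i) * ((-1) ^ k * N) = (-1) ^ (k - (i : ℕ)) * P' := by
    calc (ηnew d * (-1) ^ (i : ℕ) * βnew d i) * ((-1) ^ k * N)
        = ηnew d * ((-1) ^ (i : ℕ) * (-1) ^ k) * (βnew d i * N) := by ring
      _ = ηnew d * ((-1) ^ (i : ℕ) * (-1) ^ k) * (ηnew d * P') := by rw [hkey]
      _ = (ηnew d * ηnew d) * ((-1) ^ (i : ℕ) * (-1) ^ k) * P' := by ring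
      _ = (-1) ^ (k - (i : ℕ)) * P' := by rw [hηsq, hpow, one_mul]
  by_contra hcon
  have hcon' : ηnew d * (-1) ^ (i : ℕ) * βnew d i ≤ 0 := not_lt.mp hcon
  have h2 := mul_nonpos_of_nonpos_of_nonneg hcon' hN.le
  rw [h1] at h2
  exact absurd hP (not_lt.mpr h2)

end Secular

end Summit.ValiantsHypothesis.ValiantsHypothesis.Theorems.LacunarySymmetroidMatrixDescartes.Census.LagrangeTower
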